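import Mathlib
import HarnessLib
import Summits.NavierStokesRegularity.NavierStokesRegularity.Theorems.HalfSpaceWindowDoorCirculationCarryingRigidityGaussExtremalHessian

/-!
# Route `HalfSpaceWindowDoor`, crux `CirculationCarryingRigidity` (stmt-NavierStokesRegularity-25311) —
# the SHARPENED TILTING WINDOW at the Gaussian-extremal point: `(2 − 2C)·∫G₁ω₃ ≤ 𝒯 ≤ (2 + 2C)·∫G₁ω₃`

LEAD ns-hsw-p1 g8 (cell pub-ns-dss), `--supports stmt-NavierStokesRegularity-25311 --as helper`; sequel of `…GaussExtremalHessian`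
(this seat: HORIZONTAL Gaussian moment `∫(y₀²+y₁²)G₁ω₃ ≤ 4∫G₁ω₃` at the extremal point, from the full Hessian condition) and of
`…GaussExtremalTilting` (LEAD g7: `𝒜 − 𝒯 = −2∫G₁ω₃`, `|𝒜| ≤ √6·C·∫G₁ω₃` from the TRACE bound `⟨‖y‖²⟩ ≤ 6`).  Reading the
maximal-inflow identity (E3) through the kinematic swirl–inflow identity O1b (`gaussianInflowIdentity_holds`), with the Gaussian
RADIAL-INFLOW moment `𝒜 = ∫G₁(x_h·u_h)ω₃` and TILTING moment `𝒯 = ∫G₁(x_h·ω_h)u₃` of the extremal slice `u = W(−1)`: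

* `abs_horiz_dot_le_quad` — `|x_h·u_h| ≤ C·(‖x_h‖²/4 + 1)` for `‖u‖ ≤ C` (Cauchy–Schwarz + AM–GM, square-root free);
* `gaussExtremal_tilting_sharp` — `𝒜 − 𝒯 = −2M₀`, **`|𝒜| ≤ 2C·M₀`** (sign `ω₃ ≥ 0`, `‖u‖ ≤ C`, horizontal moment `≤ 4M₀`), hence
  **`(2 − 2C)·M₀ ≤ 𝒯 ≤ (2 + 2C)·M₀`**, `M₀ = ∫G₁ω₃ > 0` (g7 had `2 ± √6·C`).  For every Type-I constant `C < 1` the extremal enemy converts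
  horizontal into vertical vorticity with a POSITIVE Gaussian tilting moment `𝒯 ≥ (2 − 2C)M₀`: in Gaussian mean about the extremal axis
  the horizontal vorticity points outward where the fluid rises and inward where it sinks; radial inflow of `ω₃ ≥ 0` alone cannot pay (E3)
  unless `C ≥ 1`.
* `hemisphereLiouvilleE3_of_tilting_sharp`, `circulationCarryingRigidity_of_tilting_sharp` — the corresponding reductions.

WHAT THIS IS NOT: not a statement about Navier–Stokes regularity; door statements concern HYPOTHETICAL blow-up profiles (KNSS ancient
mild solutions).  No item is closed by this file.
-/

noncomputable section

-- the summit and its single sub-problem share the name (CONVENTIONS §1), as in every Theorems file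
set_option linter.dupNamespace false

namespace Summit.NavierStokesRegularity.NavierStokesRegularity.Theorems.HalfSpaceWindowDoorCirculationCarryingRigidityGaussExtremalTiltingSharp

open MeasureTheory Set Function Filter Topology
open scoped RealInnerProductSpace InnerProductSpace
open Literature.Analysis Literature.Analysis.FluidPDE Literature.Analysis.UnboundedOperators
open Summit.NavierStokesRegularity.NavierStokesRegularity.Theses.HalfSpaceWindowDoor
open Summit.NavierStokesRegularity.NavierStokesRegularity.Theorems.HalfSpaceWindowDoorCirculationCarryingRigidityDefs
open Summit.NavierStokesRegularity.NavierStokesRegularity.Theorems.HalfSpaceWindowDoorCirculationCarryingRigidityReduction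
  (circulationCarryingRigidity_of_hemisphereLiouvilleE3)
open Summit.NavierStokesRegularity.NavierStokesRegularity.Theorems.HalfSpaceWindowDoorCirculationCarryingRigidityGaussKernel
  (inner_e3_apply)
open Summit.NavierStokesRegularity.NavierStokesRegularity.Theorems.HalfSpaceWindowDoorCirculationCarryingRigidityGaussSwirlLaw
  (gaussianInflowIdentity_holds)
open Summit.NavierStokesRegularity.NavierStokesRegularity.Theorems.HalfSpaceWindowDoorCirculationCarryingRigidityGaussExtremalConditions
  (omega3_continuous_bounded)
open Summit.NavierStokesRegularity.NavierStokesRegularity.Theorems.HalfSpaceWindowDoorCirculationCarryingRigidityGaussExtremalTilting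
  (slice_components abs_horiz_dot_le abs_horiz_dot_le_two)
open Summit.NavierStokesRegularity.NavierStokesRegularity.Theorems.HalfSpaceWindowDoorCirculationCarryingRigidityGaussExtremalHessian
  (gaussExtremal_hessian_coord)

variable {C : ℝ}

/-- Horizontal Cauchy–Schwarz + AM–GM without square roots: `|y₀u₀ + y₁u₁| ≤ C·((y₀² + y₁²)/4 + 1)` whenever `‖u‖ ≤ C`
(`|y_h·u_h| ≤ ‖y_h‖·C` and `‖y_h‖ ≤ ‖y_h‖²/4 + 1`). -/
theorem abs_horiz_dot_le_quad (y u : EuclideanSpace ℝ (Fin 3)) {C : ℝ} (hu : ‖u‖ ≤ C) :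
    |y 0 * u 0 + y 1 * u 1| ≤ C * ((y 0 ^ 2 + y 1 ^ 2) / 4 + 1) := by
  have hC : 0 ≤ C := (norm_nonneg _).trans hu
  have hlag : (y 0 * u 0 + y 1 * u 1) ^ 2 ≤ (y 0 ^ 2 + y 1 ^ 2) * (u 0 ^ 2 + u 1 ^ 2) := by
    nlinarith [sq_nonneg (y 0 * u 1 - y 1 * u 0)]
  have huu : u 0 ^ 2 + u 1 ^ 2 ≤ C ^ 2 :=
    (Literature.Analysis.FluidPDE.Wei2016.sq_add_sq_le_norm_sq u).trans (pow_le_pow_left₀ (norm_nonneg _) hu 2)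
  have hq : 0 ≤ y 0 ^ 2 + y 1 ^ 2 := by positivity
  have h1 : (y 0 * u 0 + y 1 * u 1) ^ 2 ≤ (y 0 ^ 2 + y 1 ^ 2) * C ^ 2 := hlag.trans (mul_le_mul_of_nonneg_left huu hq)
  have hle : (y 0 * u 0 + y 1 * u 1) ^ 2 ≤ (C * ((y 0 ^ 2 + y 1 ^ 2) / 4 + 1)) ^ 2 := by
    nlinarith [sq_nonneg (C * ((y 0 ^ 2 + y 1 ^ 2) / 4 - 1)), sq_nonneg C]
  exact abs_le_of_sq_le_sq hle (by positivity)

/-- **THE SHARPENED TILTING WINDOW at the Gaussian-extremal point.**  If some closed-hemisphere door-class profile (Type-I constant `C`)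
has `⟪curl v(s₁)(y₁), e₃⟫ > 0` somewhere, there is a closed-hemisphere door-class `W` (constant `C`) whose slice `u = W(−1)`, `ω = curl u`,
has `M₀ = ∫G₁ω₃ > 0` and, with the Gaussian RADIAL-INFLOW moment `𝒜 = ∫G₁(x_h·u_h)ω₃` and TILTING moment `𝒯 = ∫G₁(x_h·ω_h)u₃`:
`𝒜 − 𝒯 = −2M₀` (E3 read through O1b), `|𝒜| ≤ 2C·M₀` (sign, `‖u‖ ≤ C`, horizontal moment `≤ 4M₀`), hence
**`(2 − 2C)·M₀ ≤ 𝒯 ≤ (2 + 2C)·M₀`**. -/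
theorem gaussExtremal_tilting_sharp {v : ℝ → EuclideanSpace ℝ (Fin 3) → EuclideanSpace ℝ (Fin 3)} (hv : InDoorClass C v)
    (hsign : SignE3 v) (hpos : ∃ s < 0, ∃ y, 0 < ⟪curl (v s) y, e3⟫) :
    ∃ W : ℝ → EuclideanSpace ℝ (Fin 3) → EuclideanSpace ℝ (Fin 3), InDoorClass C W ∧ SignE3 W ∧
      0 < ∫ y, heatKernel 1 y * curl (W (-1)) y 2 ∧
      (∫ y, heatKernel 1 y * ((y 0 * W (-1) y 0 + y 1 * W (-1) y 1) * curl (W (-1)) y 2)) -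
          (∫ y, heatKernel 1 y * ((y 0 * curl (W (-1)) y 0 + y 1 * curl (W (-1)) y 1) * W (-1) y 2)) =
        -2 * ∫ y, heatKernel 1 y * curl (W (-1)) y 2 ∧
      |∫ y, heatKernel 1 y * ((y 0 * W (-1) y 0 + y 1 * W (-1) y 1) * curl (W (-1)) y 2)| ≤
        2 * C * ∫ y, heatKernel 1 y * curl (W (-1)) y 2 ∧
      (2 - 2 * C) * ∫ y, heatKernel 1 y * curl (W (-1)) y 2 ≤
        ∫ y, heatKernel 1 y * ((y 0 * curl (W (-1)) y 0 + y 1 * curl (W (-1)) y 1) * W (-1) y 2) ∧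
      ∫ y, heatKernel 1 y * ((y 0 * curl (W (-1)) y 0 + y 1 * curl (W (-1)) y 1) * W (-1) y 2) ≤
        (2 + 2 * C) * ∫ y, heatKernel 1 y * curl (W (-1)) y 2 := by
  obtain ⟨W, hW, hWs, h0, -, hhor, -, hI⟩ := gaussExtremal_hessian_coord hv hsign hpos
  have hm1 : (-1 : ℝ) < 0 := by norm_num
  set M₀ : ℝ := ∫ y, heatKernel 1 y * curl (W (-1)) y 2 with hM₀
  set Mh : ℝ := ∫ y, ((y 0) ^ 2 + (y 1) ^ 2) * heatKernel 1 y * curl (W (-1)) y 2 with hMh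
  -- slice data
  obtain ⟨hvc, -, hωc, K, hωK⟩ := slice_components hW hm1
  have hvC : ∀ x, ‖W (-1) x‖ ≤ C := fun x => by
    have h := hW.1 (-1) hm1 x; rwa [neg_neg, Real.sqrt_one, div_one] at h
  have hC0 : 0 ≤ C := (norm_nonneg _).trans (hvC 0)
  have hK0 : 0 ≤ K := (abs_nonneg _).trans (hωK 0 0)
  have hv2 : ∀ x, |W (-1) x 2| ≤ C := fun x =>
    ((Real.norm_eq_abs _).symm.le.trans (PiLp.norm_apply_le (W (-1) x) 2)).trans (hvC x)
  have hω3nn : ∀ x, 0 ≤ curl (W (-1)) x 2 := fun x => by rw [← inner_e3_apply]; exact hWs (-1) hm1 x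
  -- O1b at `(t, x₀, s) = (1, 0, -1)`
  have hO1b := gaussianInflowIdentity_holds C W hW 0 1 (-1) one_pos hm1
  simp only [sub_zero, mul_one] at hO1b
  set A : ℝ := ∫ y, heatKernel 1 y * ((y 0 * W (-1) y 0 + y 1 * W (-1) y 1) * curl (W (-1)) y 2) with hA
  set T : ℝ := ∫ y, heatKernel 1 y * ((y 0 * curl (W (-1)) y 0 + y 1 * curl (W (-1)) y 1) * W (-1) y 2) with hT
  -- integrability of the pieces
  have hmom1 : Integrable (fun y : EuclideanSpace ℝ (Fin 3) => heatKernel 1 y * ‖y‖) :=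
    integrable_heatKernel_mul_norm (E := EuclideanSpace ℝ (Fin 3)) one_pos
  have hcont_yi : ∀ i : Fin 3, Continuous fun y : EuclideanSpace ℝ (Fin 3) => y i := fun i =>
    (continuous_apply i).comp (PiLp.continuous_ofLp 2 _)
  have hG1c : Continuous fun y : EuclideanSpace ℝ (Fin 3) => heatKernel 1 y := by
    unfold heatKernel; fun_prop
  have hintA : Integrable (fun y : EuclideanSpace ℝ (Fin 3) =>
      heatKernel 1 y * ((y 0 * W (-1) y 0 + y 1 * W (-1) y 1) * curl (W (-1)) y 2)) := by
    refine Integrable.mono' (hmom1.const_mul (C * K)) ?_ (ae_of_all _ fun y => ?_)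
    · exact (hG1c.mul ((((hcont_yi 0).mul (hvc 0)).add ((hcont_yi 1).mul (hvc 1))).mul (hωc 2))).aestronglyMeasurable
    · have hG : 0 ≤ heatKernel 1 y := (heatKernel_pos one_pos _).le
      rw [Real.norm_eq_abs, abs_mul, abs_of_nonneg hG, abs_mul]
      calc heatKernel 1 y * (|y 0 * W (-1) y 0 + y 1 * W (-1) y 1| * |curl (W (-1)) y 2|)
          ≤ heatKernel 1 y * ((‖y‖ * C) * K) :=
            mul_le_mul_of_nonneg_left (mul_le_mul
              (abs_horiz_dot_le y (W (-1) y) (hvC y)) (hωK 2 y) (abs_nonneg _) (by positivity)) hG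
        _ = C * K * (heatKernel 1 y * ‖y‖) := by ring
  have hintT : Integrable (fun y : EuclideanSpace ℝ (Fin 3) =>
      heatKernel 1 y * ((y 0 * curl (W (-1)) y 0 + y 1 * curl (W (-1)) y 1) * W (-1) y 2)) := by
    refine Integrable.mono' (hmom1.const_mul (2 * K * C)) ?_ (ae_of_all _ fun y => ?_)
    · exact (hG1c.mul ((((hcont_yi 0).mul (hωc 0)).add ((hcont_yi 1).mul (hωc 1))).mul (hvc 2))).aestronglyMeasurable
    · have hG : 0 ≤ heatKernel 1 y := (heatKernel_pos one_pos _).le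
      rw [Real.norm_eq_abs, abs_mul, abs_of_nonneg hG, abs_mul]
      calc heatKernel 1 y * (|y 0 * curl (W (-1)) y 0 + y 1 * curl (W (-1)) y 1| * |W (-1) y 2|)
          ≤ heatKernel 1 y * ((2 * K * ‖y‖) * C) :=
            mul_le_mul_of_nonneg_left (mul_le_mul (abs_horiz_dot_le_two y (curl (W (-1)) y) (fun i => hωK i y)) (hv2 y)
              (abs_nonneg _) (by positivity)) hG
        _ = 2 * K * C * (heatKernel 1 y * ‖y‖) := by ring
  -- O1b integral = `𝒜 − 𝒯`
  have hsplit : ∫ x : EuclideanSpace ℝ (Fin 3), heatKernel 1 x *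
      (x 0 * (W (-1) x 0 * curl (W (-1)) x 2 - curl (W (-1)) x 0 * W (-1) x 2) +
        x 1 * (W (-1) x 1 * curl (W (-1)) x 2 - curl (W (-1)) x 1 * W (-1) x 2)) = A - T := by
    rw [hA, hT, ← integral_sub hintA hintT]
    congr 1; funext x; ring
  rw [hsplit] at hO1b
  -- (E3) ⇒ `𝒜 − 𝒯 = −2 M₀`
  have hc : 0 < (4 * Real.pi) ^ ((3 : ℝ) / 2) * 2 := by positivity
  have hAT : A - T = -2 * M₀ := by
    have h' : (4 * Real.pi) ^ ((3 : ℝ) / 2) * 2 * (A - T) = (4 * Real.pi) ^ ((3 : ℝ) / 2) * 2 * (-2 * M₀) := by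
      rw [← hO1b, hI]; ring
    exact mul_left_cancel₀ hc.ne' h'
  -- `|𝒜| ≤ 2 C M₀` from the HORIZONTAL moment bound `Mh ≤ 4 M₀`
  have hint0 : Integrable (fun y : EuclideanSpace ℝ (Fin 3) => heatKernel 1 y * curl (W (-1)) y 2) := by
    obtain ⟨hωc', B, hωB'⟩ := omega3_continuous_bounded hW hm1
    have h := ((integrable_heatKernel_holds (E := EuclideanSpace ℝ (Fin 3)) one_pos).bdd_mul hωc'.aestronglyMeasurable
      (ae_of_all _ fun x => hωB' x))
    refine h.congr (ae_of_all _ fun x => ?_)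
    show ⟪curl (W (-1)) x, e3⟫ * heatKernel 1 x = heatKernel 1 x * curl (W (-1)) x 2
    rw [inner_e3_apply, mul_comm]
  have hinth : Integrable (fun y : EuclideanSpace ℝ (Fin 3) => ((y 0) ^ 2 + (y 1) ^ 2) * heatKernel 1 y * curl (W (-1)) y 2) := by
    obtain ⟨hωc', B, hωB'⟩ := omega3_continuous_bounded hW hm1
    have h2 := ((integrable_norm_sq_mul_heatKernel (E := EuclideanSpace ℝ (Fin 3)) one_pos).bdd_mul hωc'.aestronglyMeasurable
      (ae_of_all _ fun x => hωB' x))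
    refine h2.mono ((((((hcont_yi 0).pow 2).add ((hcont_yi 1).pow 2)).mul hG1c).mul (hωc 2))).aestronglyMeasurable
      (ae_of_all _ fun y => ?_)
    have hG : 0 ≤ heatKernel 1 y := (heatKernel_pos one_pos _).le
    have hq : 0 ≤ (y 0) ^ 2 + (y 1) ^ 2 := by positivity
    have hyq : (y 0) ^ 2 + (y 1) ^ 2 ≤ ‖y‖ ^ 2 := Literature.Analysis.FluidPDE.Wei2016.sq_add_sq_le_norm_sq y
    have he : ⟪curl (W (-1)) y, e3⟫ = curl (W (-1)) y 2 := inner_e3_apply _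
    rw [Real.norm_eq_abs, abs_mul, abs_mul, abs_of_nonneg hq, abs_of_nonneg hG, Real.norm_eq_abs, abs_mul, he, abs_mul,
      abs_of_nonneg (sq_nonneg ‖y‖), abs_of_nonneg hG]
    calc ((y 0) ^ 2 + (y 1) ^ 2) * heatKernel 1 y * |curl (W (-1)) y 2| ≤ ‖y‖ ^ 2 * heatKernel 1 y * |curl (W (-1)) y 2| := by
          gcongr
      _ = |curl (W (-1)) y 2| * (‖y‖ ^ 2 * heatKernel 1 y) := by ring
  have hAbs : |A| ≤ 2 * C * M₀ := by
    have hdom : ∀ y : EuclideanSpace ℝ (Fin 3), ‖heatKernel 1 y * ((y 0 * W (-1) y 0 + y 1 * W (-1) y 1) * curl (W (-1)) y 2)‖ ≤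
        C * ((1 / 4) * (((y 0) ^ 2 + (y 1) ^ 2) * heatKernel 1 y * curl (W (-1)) y 2) + (heatKernel 1 y * curl (W (-1)) y 2)) := by
      intro y
      have hG : 0 ≤ heatKernel 1 y := (heatKernel_pos one_pos _).le
      have hω := hω3nn y
      have h1 := abs_horiz_dot_le_quad y (W (-1) y) (hvC y)
      rw [Real.norm_eq_abs, abs_mul, abs_of_nonneg hG, abs_mul, abs_of_nonneg hω]
      calc heatKernel 1 y * (|y 0 * W (-1) y 0 + y 1 * W (-1) y 1| * curl (W (-1)) y 2)
          ≤ heatKernel 1 y * ((C * ((y 0 ^ 2 + y 1 ^ 2) / 4 + 1)) * curl (W (-1)) y 2) :=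
            mul_le_mul_of_nonneg_left (mul_le_mul_of_nonneg_right h1 hω) hG
        _ = C * ((1 / 4) * (((y 0) ^ 2 + (y 1) ^ 2) * heatKernel 1 y * curl (W (-1)) y 2) + (heatKernel 1 y * curl (W (-1)) y 2)) := by
            ring
    have hintB : Integrable (fun y : EuclideanSpace ℝ (Fin 3) =>
        C * ((1 / 4) * (((y 0) ^ 2 + (y 1) ^ 2) * heatKernel 1 y * curl (W (-1)) y 2) + (heatKernel 1 y * curl (W (-1)) y 2))) :=
      ((hinth.const_mul _).add hint0).const_mul C
    have hnorm := norm_integral_le_of_norm_le hintB (Eventually.of_forall hdom)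
    rw [Real.norm_eq_abs] at hnorm
    have hval : ∫ y : EuclideanSpace ℝ (Fin 3),
        C * ((1 / 4) * (((y 0) ^ 2 + (y 1) ^ 2) * heatKernel 1 y * curl (W (-1)) y 2) + (heatKernel 1 y * curl (W (-1)) y 2)) =
        C * ((1 / 4) * Mh + M₀) := by
      rw [integral_const_mul, integral_add (hinth.const_mul _) hint0, integral_const_mul]
    rw [hval] at hnorm
    have hMh : (1 / 4) * Mh ≤ (1 / 4) * (4 * M₀) := mul_le_mul_of_nonneg_left hhor (by norm_num)
    calc |A| ≤ C * ((1 / 4) * Mh + M₀) := hnorm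
      _ ≤ C * ((1 / 4) * (4 * M₀) + M₀) := by gcongr
      _ = 2 * C * M₀ := by ring
  -- conclude
  have hT_eq : T = A + 2 * M₀ := by linarith
  obtain ⟨hAlo, hAhi⟩ := abs_le.1 hAbs
  have hlo : (2 - 2 * C) * M₀ ≤ T := by rw [hT_eq]; nlinarith
  have hhi : T ≤ (2 + 2 * C) * M₀ := by rw [hT_eq]; nlinarith
  exact ⟨W, hW, hWs, h0, hAT, hAbs, hlo, hhi⟩

/-! ### Reductions of W6 and of the crux -/

/-- **REDUCTION: W6 from the sharpened tilting window.**  If no closed-hemisphere door-class profile has, at `(1, −1, 0)`, positive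
Gaussian vertical vorticity and a Gaussian tilting moment in the window `[(2 − 2C)∫G₁ω₃, (2 + 2C)∫G₁ω₃]`, then `HemisphereLiouvilleE3`
holds. -/
theorem hemisphereLiouvilleE3_of_tilting_sharp
    (h : ∀ (C : ℝ) (W : ℝ → EuclideanSpace ℝ (Fin 3) → EuclideanSpace ℝ (Fin 3)), InDoorClass C W → SignE3 W →
      0 < ∫ y, heatKernel 1 y * curl (W (-1)) y 2 →
      (2 - 2 * C) * ∫ y, heatKernel 1 y * curl (W (-1)) y 2 ≤
        ∫ y, heatKernel 1 y * ((y 0 * curl (W (-1)) y 0 + y 1 * curl (W (-1)) y 1) * W (-1) y 2) →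
      ∫ y, heatKernel 1 y * ((y 0 * curl (W (-1)) y 0 + y 1 * curl (W (-1)) y 1) * W (-1) y 2) ≤
        (2 + 2 * C) * ∫ y, heatKernel 1 y * curl (W (-1)) y 2 → False) :
    HemisphereLiouvilleE3 := by
  intro C v hrate hcont hmild hdiv hsign s hs y
  by_contra hne
  have hpos : 0 < ⟪curl (v s) y, e3⟫ := lt_of_le_of_ne (hsign s hs y) (Ne.symm hne)
  obtain ⟨W, hW, hWs, h0, -, -, h1, h2⟩ := gaussExtremal_tilting_sharp (C := C) ⟨hrate, hcont, hmild, hdiv⟩ hsign ⟨s, hs, y, hpos⟩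
  exact h C W hW hWs h0 h1 h2

/-- **The crux from the sharpened tilting window** (composition with the landed plumbing `stub_rotate`). -/
theorem circulationCarryingRigidity_of_tilting_sharp
    (h : ∀ (C : ℝ) (W : ℝ → EuclideanSpace ℝ (Fin 3) → EuclideanSpace ℝ (Fin 3)), InDoorClass C W → SignE3 W →
      0 < ∫ y, heatKernel 1 y * curl (W (-1)) y 2 →
      (2 - 2 * C) * ∫ y, heatKernel 1 y * curl (W (-1)) y 2 ≤
        ∫ y, heatKernel 1 y * ((y 0 * curl (W (-1)) y 0 + y 1 * curl (W (-1)) y 1) * W (-1) y 2) →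
      ∫ y, heatKernel 1 y * ((y 0 * curl (W (-1)) y 0 + y 1 * curl (W (-1)) y 1) * W (-1) y 2) ≤
        (2 + 2 * C) * ∫ y, heatKernel 1 y * curl (W (-1)) y 2 → False) :
    CirculationCarryingRigidity :=
  circulationCarryingRigidity_of_hemisphereLiouvilleE3 (hemisphereLiouvilleE3_of_tilting_sharp h)

end Summit.NavierStokesRegularity.NavierStokesRegularity.Theorems.HalfSpaceWindowDoorCirculationCarryingRigidityGaussExtremalTiltingSharp

end
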